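import Summits.SmoothPoincare4.SmoothPoincare4.Theorems.DottedCircleRasmussenDcrGapHelperFriendsCarrierVkPartCSmooth

/-!
# Helper `helper_friendsCarrier_Vk_partC` (V_k part C: the collar of the uninverted model disc exterior) —
# piece 6: smoothness of the inverse collar
(item stmt-SmoothPoincare4-16128, route route-SmoothPoincare4-DottedCircleRasmussen)

Sixth piece of the port of the tree's `SliceDiscEndCollar.lean` to `M_k ⊂ ℝ⁴` (definitions in
`…VkPartCDatum`; `…Chart`, `…Formulas`, `…Region`, `…Smooth`).  The inverse collar `collarInv` is `C^∞`
on the collar region (`Pres.contMDiffOn_collarInv`):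

* on the (open) shell region it is `z ↦ (jM (drop z), -log E_{s₀}(depth z))`, smooth by the flow chart
  (`drop`, `depth` are smooth on the band; template: the polar chart of `S³ ⊂ ℝ⁴`);
* on the image of the tube-regime set `Pset` of the tube coordinates it is the tube inverse formula
  (agreement shell/tube inverse formulas at the shallow points of the unit tube), smooth through `Ginv`,
  the profile `Ψ`, the tube `ν` and `jM`;
* on the image of the flat-regime set `Fset` it is the flat inverse formula (agreement tube/flat through
  the gluing relation `jM (ν(u, t v)) = jB (t u, v)`), smooth through `Ginv` and the solid torus `jB`;
* `helper_friendsCarrier_Vk_partC_smoothInverse` — the registered summary: the collar is a `C^∞` bijection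
  onto its open image with `C^∞` inverse.

Everything is proved; no definitions, no named facts, no `sorry`.
References: Manolescu–Piccirillo (2023), §3.2 [ManolescuPiccirillo2023]; Kirby (1989), Ch. I §5 [Kirby1989].
-/

-- the prescribed namespace `Summit.<P>.<Sub>.…` duplicates `SmoothPoincare4` (P = Sub)
set_option linter.dupNamespace false
set_option linter.style.longLine false

noncomputable section

open scoped Manifold ContDiff Topology
open Function Set Metric
open Literature.Topology.FourManifolds Literature.Topology.FourManifolds.MMSW

namespace Summit.SmoothPoincare4.SmoothPoincare4.Theorems.DcrGap.MkFriends

namespace FriendsVk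

namespace CollarDatum

variable {k : ℕ} (V : CollarDatum k)

/-! ### The shell region and the shell inverse formula -/

/-- Shells lie in the band. [folklore] -/
theorem shell_subset_band (s : ℝ) : V.shell s ⊆ V.band := fun _ hz => hz.1

/-- The shell region is open. [folklore] -/
theorem isOpen_radSetT : IsOpen V.radSetT :=
  (V.contDiffOn_drop.continuousOn.mono (V.shell_subset_band V.s₀)).isOpen_inter_preimage (V.isOpen_shell V.s₀)
    V.isClosed_unitTube.isOpen_compl

/-- A point of `G(dom)` in the shell region is a shallow flow point of the tube with normal radius `> 1`. [folklore] -/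
theorem shallow_of_mem_radSetT {q : (EuclideanSpace ℝ (Fin 2)) × (EuclideanSpace ℝ (Fin 2))}
    (hq : q ∈ (ConicalDiscTube.dom : Set ((EuclideanSpace ℝ (Fin 2)) × (EuclideanSpace ℝ (Fin 2))))) (hz : V.G q ∈ V.radSetT) :
    1 - V.s₀ < ‖q.1‖ ∧ 1 < ‖q.2‖ := by
  obtain ⟨x, w⟩ := q
  obtain ⟨hshell, hdir⟩ := hz
  obtain ⟨h1, h2⟩ := ConicalDiscTube.mem_dom_iff.1 hq
  have hx : 1 - V.s₀ < ‖x‖ := by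
    by_contra h
    exact V.G_not_mem_shell (not_lt.1 h) h2 hshell
  refine ⟨hx, ?_⟩
  by_contra hw
  rw [not_lt] at hw
  have hs : |1 - ‖x‖| < 2 * V.ε := by rw [abs_of_nonneg (by simp only at h1; linarith)]; linarith [V.s₀_lt_two]
  apply hdir
  simp only at hx h1 h2 ⊢
  rw [V.G_eq_Φ (by linarith [V.s₀_lt]) h1 h2, V.drop_Φ (V.ν_mem _) hs, V.mem_unitTube_iff]
  exact hw

/-- **Shell = tube inverse formula on the overlap**: at a flow point `G (x, w)` of the tube with
`1 - s₀ < ‖x‖ < 1` and `1 ≤ ‖w‖ < 2`. [folklore] -/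
theorem ΨRad_eq_ΨTube {Y : Type*} (jM : EuclideanSpace ℝ (Fin 4) → Y) {x w : EuclideanSpace ℝ (Fin 2)} (hx1 : 1 - V.s₀ < ‖x‖) (hx2 : ‖x‖ < 1)
    (hw1 : 1 ≤ ‖w‖) (hw2 : ‖w‖ < 2) : V.ΨRad jM (V.G (x, w)) = V.ΨTube jM (V.G (x, w)) := by
  have hxpos : 0 < ‖x‖ := by linarith [V.depth₀_lt_one]
  have hwpos : 0 < ‖w‖ := by linarith
  have hdom : ((x, w) : (EuclideanSpace ℝ (Fin 2)) × (EuclideanSpace ℝ (Fin 2))) ∈ (ConicalDiscTube.dom : Set ((EuclideanSpace ℝ (Fin 2)) × (EuclideanSpace ℝ (Fin 2)))) :=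
    ConicalDiscTube.mem_dom_iff.2 ⟨hx2, hw2⟩
  have hz : V.G (x, w) = V.Φ (1 - ‖x‖, V.ν (radialProjection (spherePt 1) x, w)) := V.G_eq_Φ (by linarith [V.s₀_lt]) hx2 hw2
  have hΨ : SliceCollar.Ψ V.s₀ (1 - ‖x‖, ‖w‖) = (‖w‖, -Real.log (SliceCollar.E V.s₀ (1 - ‖x‖))) := by
    rw [SliceCollar.Ψ_of_one_le V.s₀ (p := (1 - ‖x‖, ‖w‖)) hwpos hw1, SliceCollar.R_of_one_le hw1]
  have hs : |1 - ‖x‖| < 2 * V.ε := by rw [abs_of_nonneg (by linarith)]; linarith [V.s₀_lt_two]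
  rw [CollarDatum.ΨTube, CollarDatum.profB, V.Ginv_apply hdom, CollarDatum.ΨRad, hz, V.drop_Φ (V.ν_mem _) hs, V.depth_Φ (V.ν_mem _) hs]
  simp only [hΨ]
  rw [norm_smul_coe_radialProjection]

/-- The shell inverse formula is smooth on the shell region. [folklore] -/
theorem contMDiffAt_ΨRad_aux {Y : Type*} [TopologicalSpace Y] [ChartedSpace (EuclideanSpace ℝ (Fin 3)) Y] {jM : EuclideanSpace ℝ (Fin 4) → Y}
    {z : EuclideanSpace ℝ (Fin 4)} (hz : z ∈ V.radSetT) (hjM : ContMDiffAt 𝓘(ℝ, EuclideanSpace ℝ (Fin 4)) (𝓡 3) ∞ jM (V.drop z)) :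
    ContMDiffAt 𝓘(ℝ, EuclideanSpace ℝ (Fin 4)) ((𝓡 3).prod 𝓘(ℝ, ℝ)) ∞ (V.ΨRad jM) z := by
  obtain ⟨⟨hband, hd0, hds⟩, -⟩ := hz
  have h1 : ContMDiffAt 𝓘(ℝ, EuclideanSpace ℝ (Fin 4)) (𝓡 3) ∞ (fun y => jM (V.drop y)) z := hjM.comp z (V.contDiffAt_drop hband).contMDiffAt
  have h2 : ContDiffAt ℝ ∞ (fun y => -Real.log (SliceCollar.E V.s₀ (depth k y))) z := by
    have hE : ContDiffAt ℝ ∞ (fun y => SliceCollar.E V.s₀ (depth k y)) z :=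
      ContDiffAt.comp (g := SliceCollar.E V.s₀) (f := depth k) z (SliceCollar.contDiffAt_E V.s₀ hd0) (V.contDiffAt_depth hband)
    exact (hE.log (SliceCollar.E_pos V.s₀_pos hd0 hds).ne').neg
  exact h1.prodMk h2.contMDiffAt

/-! ### The tube regime -/

/-- The tube-regime set is open. [folklore] -/
theorem isOpen_Pset : IsOpen V.Pset := by
  have h1 : IsOpen {q : (EuclideanSpace ℝ (Fin 2)) × (EuclideanSpace ℝ (Fin 2)) | q.1 ≠ 0} := isOpen_ne.preimage continuous_fst
  have h2 : IsOpen {q : (EuclideanSpace ℝ (Fin 2)) × (EuclideanSpace ℝ (Fin 2)) | q.2 ≠ 0} := isOpen_ne.preimage continuous_snd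
  have h3 : IsOpen {q : (EuclideanSpace ℝ (Fin 2)) × (EuclideanSpace ℝ (Fin 2)) | (1 - ‖q.1‖, ‖q.2‖) ∈ SliceCollar.P V.s₀} :=
    (SliceCollar.isOpen_P V.s₀).preimage ((continuous_const.sub (continuous_norm.comp continuous_fst)).prodMk
      (continuous_norm.comp continuous_snd))
  have heq : V.Pset = (((ConicalDiscTube.dom : Set ((EuclideanSpace ℝ (Fin 2)) × (EuclideanSpace ℝ (Fin 2)))) ∩ {q | q.1 ≠ 0}) ∩ {q | q.2 ≠ 0}) ∩
      {q : (EuclideanSpace ℝ (Fin 2)) × (EuclideanSpace ℝ (Fin 2)) | (1 - ‖q.1‖, ‖q.2‖) ∈ SliceCollar.P V.s₀} := by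
    ext q; simp only [CollarDatum.Pset, mem_inter_iff, mem_setOf_eq, and_assoc]
  rw [heq]
  exact ((ConicalDiscTube.isOpen_dom.inter h1).inter h2).inter h3

/-- On `G(Pset)` the inverse collar is the tube inverse formula. [folklore] -/
theorem collarInv_eq_ΨTube_of_mem {Y : Type*} (jM : EuclideanSpace ℝ (Fin 4) → Y) (jB : ↥solidTorus → Y)
    {q : (EuclideanSpace ℝ (Fin 2)) × (EuclideanSpace ℝ (Fin 2))} (hq : q ∈ V.Pset) : V.collarInv jM jB (V.G q) = V.ΨTube jM (V.G q) := by
  obtain ⟨hqd, hx, -, -⟩ := hq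
  by_cases hz : V.G q ∈ V.radSetT
  · rw [V.collarInv_of_mem_radSetT hz]
    obtain ⟨hx1, hw1⟩ := V.shallow_of_mem_radSetT hqd hz
    exact V.ΨRad_eq_ΨTube jM hx1 (ConicalDiscTube.mem_dom_iff.1 hqd).1 hw1.le (ConicalDiscTube.mem_dom_iff.1 hqd).2
  · exact V.collarInv_of_fst_ne_zero hz (by rw [V.Ginv_apply hqd]; exact hx)

/-- The tube inverse formula is smooth on `G(Pset)`, given `jM` smooth on `M_k ∖ K₁`. [folklore] -/
theorem contMDiffAt_ΨTube_aux {Y : Type*} [TopologicalSpace Y] [ChartedSpace (EuclideanSpace ℝ (Fin 3)) Y] {jM : EuclideanSpace ℝ (Fin 4) → Y}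
    (hjM : ∀ a ∈ modelBoundary k, a ∉ range V.K₁ → ContMDiffAt 𝓘(ℝ, EuclideanSpace ℝ (Fin 4)) (𝓡 3) ∞ jM a)
    {q : (EuclideanSpace ℝ (Fin 2)) × (EuclideanSpace ℝ (Fin 2))} (hq : q ∈ V.Pset) :
    ContMDiffAt 𝓘(ℝ, EuclideanSpace ℝ (Fin 4)) ((𝓡 3).prod 𝓘(ℝ, ℝ)) ∞ (V.ΨTube jM) (V.G q) := by
  haveI : Fact (Module.finrank ℝ (EuclideanSpace ℝ (Fin 2)) = 1 + 1) := ⟨by simp⟩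
  obtain ⟨hqd, hx, hw, hP⟩ := hq
  have hN : V.G q ∈ V.N := ⟨q, hqd, rfl⟩
  have hGinv : V.Ginv (V.G q) = q := V.Ginv_apply hqd
  -- the tube coordinates are smooth
  have hxco : ContMDiffAt 𝓘(ℝ, EuclideanSpace ℝ (Fin 4)) 𝓘(ℝ, EuclideanSpace ℝ (Fin 2)) ∞ (fun z => (V.Ginv z).1) (V.G q) :=
    (contDiffAt_fst.comp _ (V.contDiffAt_Ginv hN)).contMDiffAt
  have hwco : ContMDiffAt 𝓘(ℝ, EuclideanSpace ℝ (Fin 4)) 𝓘(ℝ, EuclideanSpace ℝ (Fin 2)) ∞ (fun z => (V.Ginv z).2) (V.G q) :=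
    (contDiffAt_snd.comp _ (V.contDiffAt_Ginv hN)).contMDiffAt
  -- the profile values
  have hprof : ContMDiffAt 𝓘(ℝ, EuclideanSpace ℝ (Fin 4)) 𝓘(ℝ, ℝ × ℝ) ∞ V.profB (V.G q) := by
    have hargs : ContMDiffAt 𝓘(ℝ, EuclideanSpace ℝ (Fin 4)) 𝓘(ℝ, ℝ × ℝ) ∞ (fun z => (1 - ‖(V.Ginv z).1‖, ‖(V.Ginv z).2‖)) (V.G q) := by
      have h1 : ContMDiffAt 𝓘(ℝ, EuclideanSpace ℝ (Fin 4)) 𝓘(ℝ, ℝ) ∞ (fun z => 1 - ‖(V.Ginv z).1‖) (V.G q) := by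
        have : ContDiffAt ℝ ∞ (fun x : EuclideanSpace ℝ (Fin 2) => 1 - ‖x‖) (V.Ginv (V.G q)).1 :=
          contDiffAt_const.sub (contDiffAt_norm ℝ (by rw [hGinv]; exact hx))
        exact ContMDiffAt.comp (g := fun x : EuclideanSpace ℝ (Fin 2) => 1 - ‖x‖) (f := fun z => (V.Ginv z).1) (V.G q) this.contMDiffAt hxco
      have h2 : ContMDiffAt 𝓘(ℝ, EuclideanSpace ℝ (Fin 4)) 𝓘(ℝ, ℝ) ∞ (fun z => ‖(V.Ginv z).2‖) (V.G q) :=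
        ContMDiffAt.comp (g := fun w : EuclideanSpace ℝ (Fin 2) => ‖w‖) (f := fun z => (V.Ginv z).2) (V.G q)
          (contDiffAt_norm ℝ (by rw [hGinv]; exact hw)).contMDiffAt hwco
      exact h1.prodMk_space h2
    have hΨ : ContDiffAt ℝ ∞ (SliceCollar.Ψ V.s₀) (1 - ‖(V.Ginv (V.G q)).1‖, ‖(V.Ginv (V.G q)).2‖) := by
      rw [hGinv]; exact SliceCollar.contDiffAt_Ψ V.s₀_pos hP
    exact ContMDiffAt.comp (g := SliceCollar.Ψ V.s₀) (f := fun z => (1 - ‖(V.Ginv z).1‖, ‖(V.Ginv z).2‖)) _ hΨ.contMDiffAt hargs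
  have hτpos : 0 < (V.profB (V.G q)).1 := by
    rw [CollarDatum.profB, hGinv]; exact (SliceCollar.Ψ_mem_Strip hP).1.1
  -- second component
  have h2 : ContMDiffAt 𝓘(ℝ, EuclideanSpace ℝ (Fin 4)) 𝓘(ℝ, ℝ) ∞ (fun z => (V.profB z).2) (V.G q) :=
    ContMDiffAt.comp (g := fun r : ℝ × ℝ => r.2) (f := V.profB) _ contDiffAt_snd.contMDiffAt hprof
  -- first component `jM (ν (x̂, τ • ŵ))`
  have hτ : ContMDiffAt 𝓘(ℝ, EuclideanSpace ℝ (Fin 4)) 𝓘(ℝ, ℝ) ∞ (fun z => (V.profB z).1) (V.G q) :=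
    ContMDiffAt.comp (g := fun r : ℝ × ℝ => r.1) (f := V.profB) _ contDiffAt_fst.contMDiffAt hprof
  have hu : ContMDiffAt 𝓘(ℝ, EuclideanSpace ℝ (Fin 4)) (𝓡 1) ∞ (fun z => radialProjection (spherePt 1) (V.Ginv z).1) (V.G q) :=
    ContMDiffAt.comp (g := radialProjection (spherePt 1)) (f := fun z => (V.Ginv z).1) (V.G q)
      ((contMDiffOn_radialProjection (spherePt 1)).contMDiffAt (isOpen_ne.mem_nhds (by rw [hGinv]; exact hx))) hxco
  have hv' : ContMDiffAt 𝓘(ℝ, EuclideanSpace ℝ (Fin 4)) (𝓡 1) ∞ (fun z => radialProjection (spherePt 1) (V.Ginv z).2) (V.G q) :=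
    ContMDiffAt.comp (g := radialProjection (spherePt 1)) (f := fun z => (V.Ginv z).2) (V.G q)
      ((contMDiffOn_radialProjection (spherePt 1)).contMDiffAt (isOpen_ne.mem_nhds (by rw [hGinv]; exact hw))) hwco
  have hv : ContMDiffAt 𝓘(ℝ, EuclideanSpace ℝ (Fin 4)) 𝓘(ℝ, EuclideanSpace ℝ (Fin 2)) ∞
      (fun z => ((radialProjection (spherePt 1) (V.Ginv z).2 : Metric.sphere (0 : EuclideanSpace ℝ (Fin 2)) 1) : EuclideanSpace ℝ (Fin 2))) (V.G q) :=
    (contMDiff_coe_sphere (E := EuclideanSpace ℝ (Fin 2)) (n := 1)).contMDiffAt.comp (V.G q) hv'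
  have hfib : ContMDiffAt 𝓘(ℝ, EuclideanSpace ℝ (Fin 4)) 𝓘(ℝ, EuclideanSpace ℝ (Fin 2)) ∞
      (fun z => (V.profB z).1 • ((radialProjection (spherePt 1) (V.Ginv z).2 : Metric.sphere (0 : EuclideanSpace ℝ (Fin 2)) 1) : EuclideanSpace ℝ (Fin 2))) (V.G q) :=
    (TubeNbhd.contDiff_smul_pair (EuclideanSpace ℝ (Fin 2))).contMDiff.contMDiffAt.comp _ (hτ.prodMk_space hv)
  have hpt : ContMDiffAt 𝓘(ℝ, EuclideanSpace ℝ (Fin 4)) 𝓘(ℝ, EuclideanSpace ℝ (Fin 4)) ∞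
      (fun z => V.ν (radialProjection (spherePt 1) (V.Ginv z).1,
        (V.profB z).1 • ((radialProjection (spherePt 1) (V.Ginv z).2 : Metric.sphere (0 : EuclideanSpace ℝ (Fin 2)) 1) : EuclideanSpace ℝ (Fin 2)))) (V.G q) :=
    V.contMDiff_ν.contMDiffAt.comp (V.G q) (hu.prodMk hfib)
  have h1 : ContMDiffAt 𝓘(ℝ, EuclideanSpace ℝ (Fin 4)) (𝓡 3) ∞ (fun z => jM (V.ν (radialProjection (spherePt 1) (V.Ginv z).1,
      (V.profB z).1 • ((radialProjection (spherePt 1) (V.Ginv z).2 : Metric.sphere (0 : EuclideanSpace ℝ (Fin 2)) 1) : EuclideanSpace ℝ (Fin 2))))) (V.G q) :=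
    ContMDiffAt.comp (g := jM) (f := fun z => V.ν (radialProjection (spherePt 1) (V.Ginv z).1,
        (V.profB z).1 • ((radialProjection (spherePt 1) (V.Ginv z).2 : Metric.sphere (0 : EuclideanSpace ℝ (Fin 2)) 1) : EuclideanSpace ℝ (Fin 2)))) (V.G q)
      (hjM _ (V.ν_mem _) (V.ν_smul_not_mem_range hτpos.ne' _ _)) hpt
  exact h1.prodMk h2

/-! ### The flat regime -/

/-- The flat-regime set is open. [folklore] -/
theorem isOpen_Fset : IsOpen V.Fset := by
  have h1 : IsOpen {q : (EuclideanSpace ℝ (Fin 2)) × (EuclideanSpace ℝ (Fin 2)) | ‖q.1‖ < 1 - V.s₀} := isOpen_lt (continuous_norm.comp continuous_fst) continuous_const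
  have h2 : IsOpen {q : (EuclideanSpace ℝ (Fin 2)) × (EuclideanSpace ℝ (Fin 2)) | q.2 ≠ 0} := isOpen_ne.preimage continuous_snd
  have h3 : IsOpen {q : (EuclideanSpace ℝ (Fin 2)) × (EuclideanSpace ℝ (Fin 2)) | ‖q.2‖ < 1} := isOpen_lt (continuous_norm.comp continuous_snd) continuous_const
  have heq : V.Fset = ({q : (EuclideanSpace ℝ (Fin 2)) × (EuclideanSpace ℝ (Fin 2)) | ‖q.1‖ < 1 - V.s₀} ∩ {q | q.2 ≠ 0}) ∩ {q | ‖q.2‖ < 1} := by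
    ext q; simp only [CollarDatum.Fset, mem_inter_iff, mem_setOf_eq, and_assoc]
  rw [heq]; exact (h1.inter h2).inter h3

/-- The flat-regime set lies in the domain of the disc tube. [folklore] -/
theorem Fset_subset_dom : V.Fset ⊆ ConicalDiscTube.dom := fun q hq =>
  ConicalDiscTube.mem_dom_iff.2 ⟨by linarith [hq.1, V.s₀_pos], hq.2.2.trans one_lt_two⟩

namespace Pres

variable {V} {Y : Type*} [TopologicalSpace Y] [ChartedSpace (EuclideanSpace ℝ (Fin 3)) Y] (Q : V.Pres Y)

/-- **The solid-torus form of a tube point of `Y`**: `jM (ν(u, τ v)) = jB (τ u, v)` for `0 < τ < 1` (the gluing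
relation of the presentation). [folklore] -/
theorem jM_ν_smul (u v : Metric.sphere (0 : EuclideanSpace ℝ (Fin 2)) 1) {τ : ℝ} (hτ : 0 < τ) (hτ1 : τ < 1) :
    Q.jM (V.ν (u, τ • (v : EuclideanSpace ℝ (Fin 2)))) = TubeNbhd.jBt Q.jB (τ • (u : EuclideanSpace ℝ (Fin 2)), v) := by
  have hlt : ‖(τ • (u : EuclideanSpace ℝ (Fin 2)), v).1‖ < 1 := by simpa [norm_smul_coe_sphere hτ.le] using hτ1
  rw [TubeNbhd.jBt_of_norm_lt Q.jB hlt]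
  exact (Q.rel _ (V.ν_mem _) (V.ν_smul_not_mem_range hτ.ne' _ _) _).2 ⟨u, τ, ⟨hτ, hτ1⟩, rfl, rfl⟩

/-- **Tube = flat inverse formula on the overlap**: at a deep tube point `G (x, w)` with `0 < ‖x‖ ≤ 1 - s₀`,
`0 < ‖w‖ < 1`. [folklore] -/
theorem ΨTube_eq_ΨFlat {x w : EuclideanSpace ℝ (Fin 2)} (hx : x ≠ 0) (hx1 : ‖x‖ ≤ 1 - V.s₀) (hw : w ≠ 0) (hw1 : ‖w‖ < 1) :
    V.ΨTube Q.jM (V.G (x, w)) = V.ΨFlat Q.jB (V.G (x, w)) := by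
  have hxpos : 0 < ‖x‖ := norm_pos_iff.2 hx
  have hwpos : 0 < ‖w‖ := norm_pos_iff.2 hw
  have hdom : ((x, w) : (EuclideanSpace ℝ (Fin 2)) × (EuclideanSpace ℝ (Fin 2))) ∈ (ConicalDiscTube.dom : Set ((EuclideanSpace ℝ (Fin 2)) × (EuclideanSpace ℝ (Fin 2)))) :=
    ConicalDiscTube.mem_dom_iff.2 ⟨by linarith [V.s₀_pos], by linarith⟩
  have hΨ : SliceCollar.Ψ V.s₀ (1 - ‖x‖, ‖w‖) = (SliceCollar.T (1 - ‖x‖), -Real.log (SliceCollar.E 1 ‖w‖)) :=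
    SliceCollar.Ψ_of_le V.s₀_pos (p := (1 - ‖x‖, ‖w‖)) (by simp only; linarith [V.s₀_pos]) (by simp only; linarith) hwpos hw1
  rw [CollarDatum.ΨTube, CollarDatum.profB, V.Ginv_apply hdom, CollarDatum.ΨFlat, V.Ginv_apply hdom]
  simp only [hΨ, SliceCollar.T, sub_sub_cancel]
  refine Prod.ext ?_ rfl
  show Q.jM (V.ν (radialProjection (spherePt 1) x, (‖x‖ / 4) • ((radialProjection (spherePt 1) w : Metric.sphere (0 : EuclideanSpace ℝ (Fin 2)) 1) : EuclideanSpace ℝ (Fin 2)))) =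
    TubeNbhd.jBt Q.jB ((4 : ℝ)⁻¹ • x, radialProjection (spherePt 1) w)
  rw [Q.jM_ν_smul _ _ (by positivity) (by linarith [V.s₀_pos]), coe_radialProjection_of_ne_zero _ hx, smul_smul]
  congr 2
  field_simp

/-- On `G(Fset)` the inverse collar is the flat inverse formula. [folklore] -/
theorem collarInv_eq_ΨFlat_of_mem {q : (EuclideanSpace ℝ (Fin 2)) × (EuclideanSpace ℝ (Fin 2))} (hq : q ∈ V.Fset) :
    V.collarInv Q.jM Q.jB (V.G q) = V.ΨFlat Q.jB (V.G q) := by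
  obtain ⟨hx1, hw, hw1⟩ := hq
  have hqd := V.Fset_subset_dom ⟨hx1, hw, hw1⟩
  obtain ⟨x, w⟩ := q
  have hz : V.G (x, w) ∉ V.radSetT := V.not_mem_radSetT_of_not_mem_shell (V.G_not_mem_shell hx1.le (by simp only at hw1; linarith))
  by_cases hx : x = 0
  · exact V.collarInv_of_fst_eq_zero hz (by rw [V.Ginv_apply hqd]; exact hx)
  · rw [V.collarInv_of_fst_ne_zero hz (by rw [V.Ginv_apply hqd]; exact hx)]
    exact Q.ΨTube_eq_ΨFlat hx hx1.le hw hw1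

/-- `jBt` is smooth on the open solid torus. [folklore] -/
theorem contMDiffOn_jBt : ContMDiffOn (𝓘(ℝ, EuclideanSpace ℝ (Fin 2)).prod (𝓡 1)) (𝓡 3) ∞ (TubeNbhd.jBt Q.jB) solidTorus :=
  Q.jB_emb.contMDiff.comp_contMDiffOn (TubeNbhd.contMDiffOn_toOpens' (I := 𝓘(ℝ, EuclideanSpace ℝ (Fin 2)).prod (𝓡 1)) solidTorus TubeNbhd.basePtB)

/-- The flat inverse formula is smooth on `G(Fset)`. [folklore] -/
theorem contMDiffAt_ΨFlat {q : (EuclideanSpace ℝ (Fin 2)) × (EuclideanSpace ℝ (Fin 2))} (hq : q ∈ V.Fset) :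
    ContMDiffAt 𝓘(ℝ, EuclideanSpace ℝ (Fin 4)) ((𝓡 3).prod 𝓘(ℝ, ℝ)) ∞ (V.ΨFlat Q.jB) (V.G q) := by
  haveI : Fact (Module.finrank ℝ (EuclideanSpace ℝ (Fin 2)) = 1 + 1) := ⟨by simp⟩
  obtain ⟨hx1, hw, hw1⟩ := hq
  have hqd := V.Fset_subset_dom ⟨hx1, hw, hw1⟩
  have hN : V.G q ∈ V.N := ⟨q, hqd, rfl⟩
  have hGinv : V.Ginv (V.G q) = q := V.Ginv_apply hqd
  have hwpos : 0 < ‖q.2‖ := norm_pos_iff.2 hw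
  have hxco : ContMDiffAt 𝓘(ℝ, EuclideanSpace ℝ (Fin 4)) 𝓘(ℝ, EuclideanSpace ℝ (Fin 2)) ∞ (fun z => (V.Ginv z).1) (V.G q) :=
    (contDiffAt_fst.comp _ (V.contDiffAt_Ginv hN)).contMDiffAt
  have hwco : ContMDiffAt 𝓘(ℝ, EuclideanSpace ℝ (Fin 4)) 𝓘(ℝ, EuclideanSpace ℝ (Fin 2)) ∞ (fun z => (V.Ginv z).2) (V.G q) :=
    (contDiffAt_snd.comp _ (V.contDiffAt_Ginv hN)).contMDiffAt
  -- first component `jBt (x/4, ŵ)`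
  have hp : ContMDiffAt 𝓘(ℝ, EuclideanSpace ℝ (Fin 4)) 𝓘(ℝ, EuclideanSpace ℝ (Fin 2)) ∞ (fun z => (4 : ℝ)⁻¹ • (V.Ginv z).1) (V.G q) :=
    ContMDiffAt.comp (g := fun x : EuclideanSpace ℝ (Fin 2) => (4 : ℝ)⁻¹ • x) (f := fun z => (V.Ginv z).1) (V.G q)
      (contDiff_const_smul (4 : ℝ)⁻¹).contDiffAt.contMDiffAt hxco
  have hv : ContMDiffAt 𝓘(ℝ, EuclideanSpace ℝ (Fin 4)) (𝓡 1) ∞ (fun z => radialProjection (spherePt 1) (V.Ginv z).2) (V.G q) :=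
    ContMDiffAt.comp (g := radialProjection (spherePt 1)) (f := fun z => (V.Ginv z).2) (V.G q)
      ((contMDiffOn_radialProjection (spherePt 1)).contMDiffAt (isOpen_ne.mem_nhds (by rw [hGinv]; exact hw))) hwco
  have hpt : ContMDiffAt 𝓘(ℝ, EuclideanSpace ℝ (Fin 4)) (𝓘(ℝ, EuclideanSpace ℝ (Fin 2)).prod (𝓡 1)) ∞
      (fun z => (((4 : ℝ)⁻¹ • (V.Ginv z).1, radialProjection (spherePt 1) (V.Ginv z).2) : (EuclideanSpace ℝ (Fin 2)) × (Metric.sphere (0 : EuclideanSpace ℝ (Fin 2)) 1))) (V.G q) :=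
    hp.prodMk hv
  have hmem : ((((4 : ℝ)⁻¹ • (V.Ginv (V.G q)).1, radialProjection (spherePt 1) (V.Ginv (V.G q)).2)) : (EuclideanSpace ℝ (Fin 2)) × (Metric.sphere (0 : EuclideanSpace ℝ (Fin 2)) 1)) ∈ solidTorus := by
    rw [mem_solidTorus_iff, hGinv]
    simp only
    rw [norm_smul, Real.norm_of_nonneg (by norm_num : (0 : ℝ) ≤ 4⁻¹)]
    linarith [V.s₀_pos]
  have h1 : ContMDiffAt 𝓘(ℝ, EuclideanSpace ℝ (Fin 4)) (𝓡 3) ∞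
      (fun z => TubeNbhd.jBt Q.jB ((4 : ℝ)⁻¹ • (V.Ginv z).1, radialProjection (spherePt 1) (V.Ginv z).2)) (V.G q) :=
    ContMDiffAt.comp (g := TubeNbhd.jBt Q.jB) _ (Q.contMDiffOn_jBt.contMDiffAt (solidTorus.isOpen.mem_nhds hmem)) hpt
  -- second component
  have h2 : ContMDiffAt 𝓘(ℝ, EuclideanSpace ℝ (Fin 4)) 𝓘(ℝ, ℝ) ∞ (fun z => -Real.log (SliceCollar.E 1 ‖(V.Ginv z).2‖)) (V.G q) := by
    have hE : ContDiffAt ℝ ∞ (fun w : EuclideanSpace ℝ (Fin 2) => -Real.log (SliceCollar.E 1 ‖w‖)) (V.Ginv (V.G q)).2 := by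
      rw [hGinv]
      have hn : ContDiffAt ℝ ∞ (fun w : EuclideanSpace ℝ (Fin 2) => ‖w‖) q.2 := contDiffAt_norm ℝ hw
      have hE' : ContDiffAt ℝ ∞ (fun w : EuclideanSpace ℝ (Fin 2) => SliceCollar.E 1 ‖w‖) q.2 :=
        ContDiffAt.comp (g := SliceCollar.E 1) (f := fun w : EuclideanSpace ℝ (Fin 2) => ‖w‖) q.2 (SliceCollar.contDiffAt_E 1 hwpos) hn
      exact (hE'.log (SliceCollar.E_pos one_pos hwpos hw1).ne').neg
    exact ContMDiffAt.comp (g := fun w : EuclideanSpace ℝ (Fin 2) => -Real.log (SliceCollar.E 1 ‖w‖)) (f := fun z => (V.Ginv z).2) (V.G q)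
      hE.contMDiffAt hwco
  exact h1.prodMk h2

/-- **The inverse collar is smooth on the collar region.** [folklore] -/
theorem contMDiffOn_collarInv : ContMDiffOn 𝓘(ℝ, EuclideanSpace ℝ (Fin 4)) ((𝓡 3).prod 𝓘(ℝ, ℝ)) ∞ (V.collarInv Q.jM Q.jB) V.region := by
  intro z hz
  refine ContMDiffAt.contMDiffWithinAt ?_
  by_cases hrad : z ∈ V.radSetT
  · have hev : V.collarInv Q.jM Q.jB =ᶠ[𝓝 z] V.ΨRad Q.jM := by
      filter_upwards [V.isOpen_radSetT.mem_nhds hrad] with z' hz'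
      exact V.collarInv_of_mem_radSetT hz'
    have hdrop : V.drop z ∈ modelBoundary k := V.drop_mem hrad.1.1
    have hK : V.drop z ∉ range V.K₁ := fun h => hrad.2 (V.range_subset_unitTube h)
    exact (V.contMDiffAt_ΨRad_aux hrad (Q.contMDiffAt_jM hdrop hK)).congr_of_eventuallyEq hev
  · have hN := V.mem_N_of_region hz hrad
    have hq := V.Ginv_mem hN
    have hGz := V.G_Ginv hN
    have hw : (V.Ginv z).2 ≠ 0 := V.snd_ne_zero_of_not_mem_disc hq (by rw [hGz]; exact V.not_mem_disc_of_mem_region hz)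
    by_cases hx : (V.Ginv z).1 = 0
    · -- flat regime
      have hw1 : ‖(V.Ginv z).2‖ < 1 := V.norm_snd_lt_one hq (by rw [hGz]; exact hz) (by rw [hx]; simp; linarith [V.depth₀_lt_one])
      have hF : V.Ginv z ∈ V.Fset := ⟨by rw [hx]; simp; linarith [V.depth₀_lt_one], hw, hw1⟩
      have hev : V.collarInv Q.jM Q.jB =ᶠ[𝓝 z] V.ΨFlat Q.jB := by
        have ho : IsOpen (V.G '' V.Fset) := V.isOpen_image V.isOpen_Fset V.Fset_subset_dom
        filter_upwards [ho.mem_nhds ⟨_, hF, hGz⟩] with z' hz'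
        obtain ⟨q', hq', rfl⟩ := hz'
        exact Q.collarInv_eq_ΨFlat_of_mem hq'
      have := Q.contMDiffAt_ΨFlat hF
      rw [hGz] at this
      exact this.congr_of_eventuallyEq hev
    · -- tube regime
      have hP : V.Ginv z ∈ V.Pset := ⟨hq, hx, hw, V.mem_P_of_region hq hx (by rw [hGz]; exact hz)⟩
      have hev : V.collarInv Q.jM Q.jB =ᶠ[𝓝 z] V.ΨTube Q.jM := by
        have ho : IsOpen (V.G '' V.Pset) := V.isOpen_image V.isOpen_Pset fun q hq => hq.1
        filter_upwards [ho.mem_nhds ⟨_, hP, hGz⟩] with z' hz'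
        obtain ⟨q', hq', rfl⟩ := hz'
        exact V.collarInv_eq_ΨTube_of_mem Q.jM Q.jB hq'
      have := V.contMDiffAt_ΨTube_aux (fun a ha ha' => Q.contMDiffAt_jM ha ha') hP
      rw [hGz] at this
      exact this.congr_of_eventuallyEq hev

end Pres

end CollarDatum

end FriendsVk

/-- **Helper `helper_friendsCarrier_Vk_partC_smoothInverse`** (registered piece 6 of
`helper_friendsCarrier_Vk_partC`, line `mk_friends`, crux `DcrGap`): under the hypotheses of part C, the
collar `c : Y × ℝ → ℝ⁴` of the uninverted model disc exterior is a `C^∞` bijection of `Y × ℝ` onto an open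
subset of `ℝ⁴ ∖ (D_k ∪ Δ)` whose inverse is `C^∞` on that open set (Kirby 1989, Ch. I §5; Manolescu–Piccirillo
2023, §3.2). [cite: Kirby1989, Ch. I §5] -/
theorem helper_friendsCarrier_Vk_partC_smoothInverse : ∀ (k : ℕ) (K₁ : (sphere (0 : EuclideanSpace ℝ (Fin 2)) 1) → EuclideanSpace ℝ (Fin 4)) (Φ : ℝ × EuclideanSpace ℝ (Fin 4) → EuclideanSpace ℝ (Fin 4)) (ε s₁ s₀ : ℝ) (g : EuclideanSpace ℝ (Fin 2) → EuclideanSpace ℝ (Fin 4)) (G : EuclideanSpace ℝ (Fin 2) × EuclideanSpace ℝ (Fin 2) → EuclideanSpace ℝ (Fin 4)) (ν : (sphere (0 : EuclideanSpace ℝ (Fin 2)) 1) × EuclideanSpace ℝ (Fin 2) → EuclideanSpace ℝ (Fin 4)), IsModelKnot k K₁ → ContDiff ℝ ∞ Φ → (∀ x, Φ (0, x) = x) → (∀ s t x, Φ (s, Φ (t, x)) = Φ (s + t, x)) → 0 < ε → ε ≤ 1 / 4 → (∀ x ∈ modelBoundary k, ∀ s : ℝ, |s| ≤ 2 * ε →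 (∀ j, (1 : ℝ) / 2 < holeTerm k j (Φ (s, x))) ∧ levelFun k (Φ (s, x)) = 1 + s) → (∀ y, (∀ j, 0 < holeTerm k j y) → |levelFun k y - 1| < 2 * ε → Φ (1 - levelFun k y, y) ∈ modelBoundary k) → 0 < s₀ → s₀ < s₁ → s₁ < 2 * ε → IsModelSliceDisc k K₁ g → (∀ (u : (sphere (0 : EuclideanSpace ℝ (Fin 2)) 1)) (t : ℝ), 1 - s₁ ≤ t → t ≤ 1 → g (t • (u : EuclideanSpace ℝ (Fin 2))) = Φ (1 - t, K₁ u)) → (ContDiffOn ℝ ∞ G (ball 0 1 ×ˢ ball 0 2) ∧ InjOn G (ball 0 1 ×ˢ ball 0 2) ∧ (∀ q ∈ ball 0 1 ×ˢ ball 0 2, Injective (fderiv ℝ G q)) ∧ (∀ q ∈ ball 0 1 ×ˢ ball 0 2, G q ∉ modelHandlebody k) ∧ (∀ x ∈ ball 0 1, G (x, 0) = g x)) → (∀ (u : (sphere (0 : EuclideanSpace ℝ (Fin 2)) 1)) (t : ℝ) (w : EuclideanSpace ℝ (Fin 2)), 1 - s₁ < t → t < 1 → ‖w‖ < 2 → G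 (t • (u : EuclideanSpace ℝ (Fin 2)), w) = Φ (1 - t, ν (u, w))) → (∀ (x w : EuclideanSpace ℝ (Fin 2)), ‖x‖ ≤ 1 - s₀ → ‖w‖ < 2 → ∀ a ∈ modelBoundary k, ∀ s : ℝ, 0 < s → s < s₀ → G (x, w) ≠ Φ (s, a)) → ∀ (Y : Type) [TopologicalSpace Y] [T2Space Y] [SecondCountableTopology Y] [ChartedSpace (EuclideanSpace ℝ (Fin 3)) Y] [IsManifold (𝓡 3) ∞ Y] (jB : solidTorus → Y) (jM : EuclideanSpace ℝ (Fin 4) → Y) (W : Set (EuclideanSpace ℝ (Fin 4))) (ψ : Y → EuclideanSpace ℝ (Fin 4)), (Manifold.IsSmoothEmbedding (𝓘(ℝ, EuclideanSpace ℝ (Fin 2)).prod (𝓡 1)) (𝓡 3) ∞ jB ∧ IsOpen (range jB) ∧ ContMDiff ((𝓡 1).prod 𝓘(ℝ, EuclideanSpace ℝ (Fin 2))) 𝓘(ℝ, EuclideanSpace ℝ (Fin 4)) ∞ ν ∧ Injective ν ∧ (∀ p, Injective (mfderiv ((𝓡 1).prod 𝓘(ℝ, EuclideanSpace ℝ (Fin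 2))) 𝓘(ℝ, EuclideanSpace ℝ (Fin 4)) ν p)) ∧ (∀ p, ν p ∈ modelBoundary k) ∧ (∀ u : (sphere (0 : EuclideanSpace ℝ (Fin 2)) 1), ν (u, 0) = K₁ u) ∧ IsOpen W ∧ (∀ x ∈ modelBoundary k, x ∉ range K₁ → x ∈ W) ∧ ContMDiffOn 𝓘(ℝ, EuclideanSpace ℝ (Fin 4)) (𝓡 3) ∞ jM W ∧ IsOpen (jM '' {x : EuclideanSpace ℝ (Fin 4) | x ∈ modelBoundary k ∧ x ∉ range K₁}) ∧ ContMDiffOn (𝓡 3) 𝓘(ℝ, EuclideanSpace ℝ (Fin 4)) ∞ ψ (jM '' {x : EuclideanSpace ℝ (Fin 4) | x ∈ modelBoundary k ∧ x ∉ range K₁}) ∧ (∀ x ∈ modelBoundary k, x ∉ range K₁ → ψ (jM x) = x) ∧ jM '' {x : EuclideanSpace ℝ (Fin 4) | x ∈ modelBoundary k ∧ x ∉ range K₁} ∪ range jB = univ ∧ (∀ x ∈ modelBoundary k, x ∉ range K₁ → ∀ b : solidTorus, jM x = jB b ↔ ∃ (u : (sphere (0 : EuclideanSpace ℝ (Fin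 2)) 1)) (t : ℝ), t ∈ Ioo (0 : ℝ) 1 ∧ b.1.1 = t • (u : EuclideanSpace ℝ (Fin 2)) ∧ x = ν (u, t • (b.1.2 : EuclideanSpace ℝ (Fin 2))))) → ∃ (c : Y × ℝ → EuclideanSpace ℝ (Fin 4)) (cInv : EuclideanSpace ℝ (Fin 4) → Y × ℝ), ContMDiff ((𝓡 3).prod 𝓘(ℝ, ℝ)) 𝓘(ℝ, EuclideanSpace ℝ (Fin 4)) ∞ c ∧ IsOpen (range c) ∧ ContMDiffOn 𝓘(ℝ, EuclideanSpace ℝ (Fin 4)) ((𝓡 3).prod 𝓘(ℝ, ℝ)) ∞ cInv (range c) ∧ (∀ p, cInv (c p) = p) ∧ (∀ z ∈ range c, c (cInv z) = z) := by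
  intro k K₁ Φ ε s₁ s₀ g G ν hK hΦ hΦ0 hΦadd hε hε4 hclock hband hs₀ hs₀₁ hs₁ε hg hgcone hG hGcone hdeep Y _ _ _ _ _ jB jM W ψ
    ⟨h1, h2, h3, h4, h5, h6, h7, h8, h9, h10, h11, h12, h13, h14, h15⟩
  let V : FriendsVk.CollarDatum k :=
    FriendsVk.CollarDatum.datumOf hK hΦ hΦ0 hΦadd hε hε4 hclock hband hs₀ hs₀₁ hs₁ε hg hgcone hG hGcone hdeep h3 h4 h5 h6 h7
  obtain ⟨Q, hQM, hQB, hQψ⟩ := FriendsVk.CollarDatum.Pres.ofHyp_spec V h1 h2 h8 h9 h10 h11 h12 h13 h14 h15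
  refine ⟨V.collar Q.jM Q.jB Q.ψ, V.collarInv Q.jM Q.jB, Q.contMDiff_collar, ?_, ?_, Q.collarInv_collar, ?_⟩
  · rw [Q.range_collar]; exact V.isOpen_region
  · rw [Q.range_collar]; exact Q.contMDiffOn_collarInv
  · rw [Q.range_collar]; exact fun z hz => Q.collar_collarInv hz

end Summit.SmoothPoincare4.SmoothPoincare4.Theorems.DcrGap.MkFriends

end
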